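import Summits.HubbardSuperconductivity.HubbardSuperconductivity.Theses.AposterioriCapRg

/-!
# Sketch — crux-ideate stmt-HubbardSuperconductivity-1315 (`AposterioriCapRg.SsbToEvenTorusLro`), round 1, ideator 2

First lemmas (signatures only; Props, no proofs) of the three idea cards
`floating-mu-two-sided-pair-transfer` (A), `number-legendre-recentring` (B), `saturation-defect-area-law` (C).
Everything is stated over tree declarations (`hubbardTorus`, `hubbardTorusWith`, `pairField dWaveFormFactor`,
`IsGroundStateInSector`, `szSector`, `Matrix.minEnergyOn`, `Matrix.groundEnergy`, `Matrix.IsGroundStateVector`,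
`expect`, `dWaveSourceTorus`, `dWaveSourceDensity`, `dWaveOrderParameter`).
-/

noncomputable section

set_option linter.dupNamespace false

namespace Summit.HubbardSuperconductivity.HubbardSuperconductivity.Cruxes.SsbToEvenTorusLro.Ideator2

open Literature.MathematicalPhysics.QuantumLattice Literature.Probability.LatticeModels
open Matrix Filter Set MeasureTheory
open scoped ComplexOrder

/-- Index type of the torus Fock space. -/
abbrev ι (L : ℕ) : Type := Finset (Orb (FermionTorus 2 L))

/-- `P_L = pairField dWaveFormFactor L = √2 Δ_d`. -/
abbrev pF (L : ℕ) [NeZero L] : Matrix (ι L) (ι L) ℂ := pairField dWaveFormFactor L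

/-- Pair-order density `L⁻⁴ Re⟨φ, P†P φ⟩` (sibling `WcbcsSsbToTorusLRO.Disproof.lro`, local copy). -/
def lro (L : ℕ) [NeZero L] (φ : Fock (Orb (FermionTorus 2 L))) : ℝ :=
  (expect ((pF L)ᴴ * pF L) φ).re / (L : ℝ) ^ 4

/-- Sector ground energy of the source-free CANONICAL torus in the `(m, S^z = 0)` sector. -/
def Esec (L : ℕ) [NeZero L] (U : ℝ) (m : ℕ) : ℝ :=
  (hubbardTorus 2 L 1 U).minEnergyOn (szSector m 0)

/-! ## Card A — `floating-mu-two-sided-pair-transfer` -/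

/-- **First lemma A1 (two-sided, μ-free pair transfer under discrete convexity).** There is `C = C(U)`
(of order `t + U`, from `‖[P†,[H,P]]‖ ≤ c₂L²`, `‖[P,P†]‖ ≤ c₁L²` and `|Esec(m+2) − Esec m| ≤ C₃`) such that
for every sector ground state `ψ` of `(m+2, S^z = 0)` at which the sector energies are discretely convex,
BOTH transferred vectors `Pψ ∈ (m, 0)` and `P†ψ ∈ (m+4, 0)` have Rayleigh excess over THEIR OWN sector
ground energies at most `C L²` in un-normalised form, i.e. `≤ C/(lro ψ · L²)` per unit norm. -/
def TwoSidedPairTransfer (U : ℝ) : Prop :=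
  ∃ C : ℝ, ∀ (L : ℕ) [NeZero L] (m : ℕ) (ψ : Fock (Orb (FermionTorus 2 L))),
    IsGroundStateInSector (hubbardTorus 2 L 1 U) (m + 2) 0 ψ → star ψ ⬝ᵥ ψ = 1 →
    2 * Esec L U (m + 2) ≤ Esec L U m + Esec L U (m + 4) →
      (expect (hubbardTorus 2 L 1 U) (pF L *ᵥ ψ)).re
          - Esec L U m * (expect ((pF L)ᴴ * pF L) ψ).re ≤ C * (L : ℝ) ^ 2 ∧
      (expect (hubbardTorus 2 L 1 U) ((pF L)ᴴ *ᵥ ψ)).re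
          - Esec L U (m + 4) * (expect (pF L * (pF L)ᴴ) ψ).re ≤ C * (L : ℝ) ^ 2

/-- **First lemma A2 (exact lro inheritance under pair removal).** From `P†P P = P P†P − [P,P†]P` and
Cauchy–Schwarz `‖P†Pψ‖ ≥ ⟨ψ,P†Pψ⟩` (unit `ψ`): `⟨Pψ, P†P Pψ⟩ ≥ ⟨ψ,P†Pψ⟩² − c₁L²⟨ψ,P†Pψ⟩`, i.e.
`lro(Pψ/‖Pψ‖) ≥ lro ψ − c₁/L²`. -/
def LroInheritance : Prop :=
  ∃ c : ℝ, ∀ (L : ℕ) [NeZero L] (ψ : Fock (Orb (FermionTorus 2 L))), star ψ ⬝ᵥ ψ = 1 →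
    ((expect ((pF L)ᴴ * pF L) ψ).re) ^ 2 - c * (L : ℝ) ^ 2 * (expect ((pF L)ᴴ * pF L) ψ).re ≤
      (expect ((pF L)ᴴ * pF L) (pF L *ᵥ ψ)).re

/-- In-sector LOW-MANIFOLD RIGIDITY at threshold `τ` with tolerance `η` (the every-GS-free form of the spectral
input; replaces a `1/L` gap): on the span of eigenvectors of `H|_{(m,0)}` with energy `≤ Esec m + τ` the pair
order varies by at most `η` — stated variationally: any two unit vectors of the sector with Rayleigh quotient
`≤ Esec m + τ` that are EIGENVECTORS have `lro` within `η`. (Physically `τ` below the twist energy `2π²ρ_s`,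
`η ≍ 1/L`.) -/
def LowManifoldRigidity (U : ℝ) (τ : ℝ) (η : ℕ → ℝ) (m : ℕ → ℕ) : Prop :=
  ∃ L₀ : ℕ, ∀ (L : ℕ) [NeZero L], L₀ ≤ L → Even L →
    ∀ ψ ψ' : Fock (Orb (FermionTorus 2 L)), ∀ E E' : ℝ,
      ψ ∈ szSector (m L) 0 → ψ' ∈ szSector (m L) 0 → star ψ ⬝ᵥ ψ = 1 → star ψ' ⬝ᵥ ψ' = 1 →
      hubbardTorus 2 L 1 U *ᵥ ψ = (E : ℂ) • ψ → hubbardTorus 2 L 1 U *ᵥ ψ' = (E' : ℂ) • ψ' →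
      E ≤ Esec L U (m L) + τ → E' ≤ Esec L U (m L) + τ →
        |lro L ψ - lro L ψ'| ≤ η L

/-- The LOW MANIFOLD of sector `(m, 0)` at threshold `τ`: the span of the eigenvectors of `H|_{(m,0)}` with
eigenvalue `≤ Esec m + τ`. -/
def lowManifold (L : ℕ) [NeZero L] (U τ : ℝ) (m : ℕ) : Submodule ℂ (Fock (Orb (FermionTorus 2 L))) :=
  Submodule.span ℂ {ψ | ψ ∈ szSector m 0 ∧
    ∃ E : ℝ, hubbardTorus 2 L 1 U *ᵥ ψ = (E : ℂ) • ψ ∧ E ≤ Esec L U m + τ}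

/-- OPERATOR form of low-manifold rigidity (the form the ladder budget actually consumes): on the low manifold
the pair-order operator `P†P/L⁴` is within `η_L` of a scalar `λ_L` in operator norm — physically the
`O(L⁻¹)` fluctuation of `|Δ_d/L²|²` in every low-energy state; it implies the diagonal form above and gives
`|⟨v, P†P v⟩/L⁴ − λ_L| ≤ η_L` for every unit `v` of the manifold (in particular every ground state). Stated with
`⬝ᵥ` to avoid the sup-norm of the `Pi` type. -/
def LowManifoldRigidityOp (U τ : ℝ) (η : ℕ → ℝ) (m : ℕ → ℕ) : Prop :=
  ∃ L₀ : ℕ, ∀ (L : ℕ) [NeZero L], L₀ ≤ L → Even L → ∃ lam : ℝ,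
    ∀ v ∈ lowManifold L U τ (m L),
      (star ((((pF L)ᴴ * pF L) *ᵥ v) - ((lam * (L : ℝ) ^ 4 : ℝ) : ℂ) • v) ⬝ᵥ
          ((((pF L)ᴴ * pF L) *ᵥ v) - ((lam * (L : ℝ) ^ 4 : ℝ) : ℂ) • v)).re ≤
        (η L) ^ 2 * (L : ℝ) ^ 8 * (star v ⬝ᵥ v).re

/-! ## Card B — `number-legendre-recentring` -/

/-- **First lemma B1 (discrete Legendre recentring, pure real analysis).** For a sequence `F` (sector energies
indexed by pair number `k`, i.e. `2k` electrons), convex with second differences in `[0, c]`, and `n₀` a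
grand-canonically optimal index at chemical potential `μ` (per electron), the grand-canonical deficit of any
other index `N` is at most `c·d(d+1)/2`, `d = |N − n₀|` — the telescoping of slope deviations. -/
def DiscreteLegendreRecentring : Prop :=
  ∀ (F : ℕ → ℝ) (μ c : ℝ) (n₀ N : ℕ),
    (∀ k, F n₀ - 2 * μ * n₀ ≤ F k - 2 * μ * k) →
    (∀ k, 0 ≤ F (k + 2) - 2 * F (k + 1) + F k) →
    (∀ k, F (k + 2) - 2 * F (k + 1) + F k ≤ c) →
      F N - 2 * μ * N - (F n₀ - 2 * μ * n₀) ≤ c * ((N : ℝ) - n₀) ^ 2 / 2 + c * |(N : ℝ) - n₀|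

/-- The seeded ("quenched") canonical torus `H − (t/L²) P†P` (sibling `quenchedCan`, local copy). -/
def quenchedCan (L : ℕ) [NeZero L] (U t : ℝ) : Matrix (ι L) (ι L) ℂ :=
  hubbardTorus 2 L 1 U - ((t / (L : ℝ) ^ 2 : ℝ) : ℂ) • ((pF L)ᴴ * pF L)

/-- Its sector energies indexed by pair number `k` (`2k` electrons, `S^z = 0`). -/
def EsecQ (L : ℕ) [NeZero L] (U t : ℝ) (k : ℕ) : ℝ :=
  (quenchedCan L U t).minEnergyOn (szSector (2 * k) 0)

/-- **Stub B2 (two-sided curvature = finite-`L` thermodynamic stability + compressibility, uniformly in small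
seeds).** Near the target filling `1 − δ` (pair indices within `aL²` of `(1−δ)L²/2`) the second differences of
the seeded sector energies lie in `[c/L², C/L²]` for all seeds `t ∈ [0, t₀]`, eventually along even sides. -/
def TwoSidedCurvature (U δ : ℝ) : Prop :=
  ∃ c C t₀ a : ℝ, 0 < c ∧ 0 < a ∧ 0 < t₀ ∧ ∀ t ∈ Set.Icc (0 : ℝ) t₀, ∃ L₀ : ℕ,
    ∀ (L : ℕ) [NeZero L], L₀ ≤ L → Even L →
      ∀ k : ℕ, |(2 * k : ℝ) - (1 - δ) * (L : ℝ) ^ 2| ≤ a * (L : ℝ) ^ 2 →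
        c / (L : ℝ) ^ 2 ≤ EsecQ L U t (k + 2) - 2 * EsecQ L U t (k + 1) + EsecQ L U t k ∧
        EsecQ L U t (k + 2) - 2 * EsecQ L U t (k + 1) + EsecQ L U t k ≤ C / (L : ℝ) ^ 2

/-- **Stub B3 (Hölder regularity of seeded-ground-state pair order ACROSS sectors).** For some `γ > 0`, the
pair order of normalised sector ground states of the seeded model varies Hölder-continuously with the pair
density near `1 − δ`, uniformly in small seeds and large even sides. -/
def LroHolderAcrossSectors (U δ : ℝ) : Prop :=
  ∃ C γ t₀ a : ℝ, 0 < γ ∧ 0 < a ∧ 0 < t₀ ∧ ∀ t ∈ Set.Icc (0 : ℝ) t₀, ∃ L₀ : ℕ,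
    ∀ (L : ℕ) [NeZero L], L₀ ≤ L → Even L →
      ∀ (k k' : ℕ) (ψ ψ' : Fock (Orb (FermionTorus 2 L))),
        |(2 * k : ℝ) - (1 - δ) * (L : ℝ) ^ 2| ≤ a * (L : ℝ) ^ 2 →
        |(2 * k' : ℝ) - (1 - δ) * (L : ℝ) ^ 2| ≤ a * (L : ℝ) ^ 2 →
        IsGroundStateInSector (quenchedCan L U t) (2 * k) 0 ψ → star ψ ⬝ᵥ ψ = 1 →
        IsGroundStateInSector (quenchedCan L U t) (2 * k') 0 ψ' → star ψ' ⬝ᵥ ψ' = 1 →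
          |lro L ψ - lro L ψ'| ≤ C * (|(2 * k : ℝ) - 2 * k'| / (L : ℝ) ^ 2) ^ γ + C / (L : ℝ)

/-! ## Card C — `saturation-defect-area-law` -/

/-- **First lemma C1 (saturation-defect AREA LAW; finite `L`, every sourced ground state).** For `0 < h < h₂`
and any normalised ground vector `ψ` of the sourced torus `K_μ − h(P + P†)`, the source-free excess of `ψ`
is bounded by the saturation defect of the TRACIAL polarisation curve `s ↦ dWaveSourceDensity L U μ s`:
`Re⟨ψ, K_μ ψ⟩ − E₀(K_μ) ≤ 2L²·(h·d_L(h₂) − ∫₀ʰ d_L(s) ds)`. (Hellmann–Feynman: `E_L(h) = E_L(0) − 2L²∫₀ʰ p⁺`,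
`⟨ψ,(P+P†)ψ⟩ ≤ 2L²p⁺(h) ≤ 2L²d_L(h₂)`; `p⁺ ≥ d_L` a.e.) Compare the tree's crude `≤ 2h‖P+P†‖`. -/
def SaturationDefectAreaLaw : Prop :=
  ∀ (U μ h h₂ : ℝ), 0 < h → h < h₂ → ∀ (L : ℕ) [NeZero L] (ψ : Fock (Orb (FermionTorus 2 L))),
    (dWaveSourceTorus L U μ h).IsGroundStateVector ψ → star ψ ⬝ᵥ ψ = 1 →
      (expect (hubbardTorusWith 2 L 1 U μ) ψ).re - (hubbardTorusWith 2 L 1 U μ).groundEnergy ≤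
        2 * (L : ℝ) ^ 2 *
          (h * dWaveSourceDensity L U μ h₂ - ∫ s in (0 : ℝ)..h, dWaveSourceDensity L U μ s)

/-- **Consequence C2 (provable from C1 + Fatou + the tree sandwich; the thermodynamic input is isolated as the
limsup clause).** If `limsup_L d_L(h) → m` as `h → 0⁺` (no excess order in the limsup — automatic once
`lim_L E_L(h)/L²` exists near `0`), then sourced ground states are `o(h)`-excited: for every `ε` and all small
`h`, eventually in `L`, every normalised sourced ground vector has source-free excess `≤ ε h L²`. -/
def SourcedGroundStatesLittleOExcited (U μ : ℝ) : Prop :=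
  Tendsto (fun h : ℝ => limsup (fun L : ℕ => dWaveSourceDensity (L + 1) U μ h) atTop)
      (nhdsWithin 0 (Set.Ioi 0)) (nhds (dWaveOrderParameter U μ)) →
    ∀ ε : ℝ, 0 < ε → ∃ h₀ : ℝ, 0 < h₀ ∧ ∀ h ∈ Set.Ioo (0 : ℝ) h₀, ∃ L₀ : ℕ,
      ∀ (L : ℕ) [NeZero L], L₀ ≤ L → ∀ ψ : Fock (Orb (FermionTorus 2 L)),
        (dWaveSourceTorus L U μ h).IsGroundStateVector ψ → star ψ ⬝ᵥ ψ = 1 →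
          (expect (hubbardTorusWith 2 L 1 U μ) ψ).re - (hubbardTorusWith 2 L 1 U μ).groundEnergy ≤
            ε * h * (L : ℝ) ^ 2

/-- **Stub C3 (POLARISATION SATURATION at the source frontier; the line's load-bearing finite-size-scaling
statement, every-GS-free, about a ground-ENERGY derivative).** For some frontier constant `C₀` and every
tolerance `η`, eventually along even sides the tracial polarisation curve is flat within `η` of the order
parameter on the window `[η·C₀/L², C₀/L²]`. By C1 the excess of every sourced ground state at `h = C₀/(2L²)`
is then `O(C₀ η)` — an `O(1)` TOTAL energy made small by `η`, which is what low-manifold rigidity consumes. -/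
def PolarisationSaturation (U μ : ℝ) : Prop :=
  ∃ C₀ : ℝ, 0 < C₀ ∧ ∀ η : ℝ, 0 < η → ∃ L₀ : ℕ, ∀ (L : ℕ) [NeZero L], L₀ ≤ L → Even L →
    ∀ s ∈ Set.Icc (η * C₀ / (L : ℝ) ^ 2) (C₀ / (L : ℝ) ^ 2),
      |dWaveSourceDensity L U μ s - dWaveOrderParameter U μ| ≤ η

end Summit.HubbardSuperconductivity.HubbardSuperconductivity.Cruxes.SsbToEvenTorusLro.Ideator2
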